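import Summits.QuantumFields.YangMills.Theorems.IR.TelescopedCodingDefs
import HarnessLib

/-!
# Crux `IR` (stmt-QuantumFields-19354), line `telescoped-coding`: stub C2 (`stub_composeCoders`) — part 1, the noise algebra

Helper module for item `stmt-QuantumFields-19354` (`--supports … --as helper`), first instalment of the composition stub C2 of skeleton v2
`Cruxes/IR/Lines/telescoped_coding.lean` (vocabulary = tree constants of `Theorems/IR/TelescopedCodingDefs.lean`, p596243):
* `splitNoise` = (even, odd) sub-sequences of a sequence noise; `infinitePi_map_splitNoise` / `seqNoise_map_splitNoise`: the two halves are
  INDEPENDENT sequence noises, `(seqNoise).map splitNoise = seqNoise ⊗ seqNoise` (Mathlib's `infinitePi_map_piCongrLeft` + `infinitePi_map_curry` +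
  `measurePreserving_finTwoArrow` along the parity re-indexing `Fin 2 × (ℕ × E) ≃ ℕ × E`);
* `law_pair_of_coders` / `law_compose_of_coders`: feeding the even half to a coarse coder `Φ₁` (law = block field) and the odd half plus a
  re-blockified `Φ₁`-output to a conditional coder `Ψ` (exact conditional sampler) produces a map `Φ` with `(seqNoise).map Φ = wilsonMeasure` — the
  LAW IDENTITY of the composite coder.  No measurability of `blockField` is assumed: a.e.-measurability under the Wilson measure is READ OFF the
  coarse coder's law identity (`aemeasurable_blockField_of_law`), as is `IsProbabilityMeasure (wilsonMeasure ρ β)`.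

HONEST FRAMING: plumbing for ONE provable stub (C2) of ONE conditional line of the OPEN gap-crux `IR`; the line's loads T/U are untouched; the YM
mass gap (Clay) is NOT proved; `R4` closes only the conditional rung `BalabanLadder.UV`.
-/

set_option autoImplicit false

noncomputable section

open MeasureTheory Filter Function
open Literature.MathematicalPhysics.QuantumFieldTheory Literature.MathematicalPhysics.QuantumLattice

namespace Summit.QuantumFields.YangMills.Cruxes.IR.TelescopedCoding

/-! ## §1 Splitting a sequence noise into two independent halves (pure measure theory) -/

section Split

variable {E G : Type*} [MeasurableSpace G]

/-- The parity re-indexing `Fin 2 × (ℕ × E) ≃ ℕ × E`, `(i, (n, x)) ↦ (2n + i, x)` (second component untouched). -/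
def parityIndex (E : Type*) : Fin 2 × (ℕ × E) ≃ ℕ × E :=
  ((Equiv.prodAssoc (Fin 2) ℕ E).symm.trans
      (Equiv.prodCongr (Equiv.prodComm (Fin 2) ℕ) (Equiv.refl E))).trans
    (Equiv.prodCongr (Nat.divModEquiv 2).symm (Equiv.refl E))

/-- The parity re-indexing keeps the link component. -/
@[simp] theorem parityIndex_snd (a : Fin 2 × (ℕ × E)) : (parityIndex E a).2 = a.2.2 := rfl

/-- `parityIndex (i, (n, x)) = (2n + i, x)`. -/
theorem parityIndex_apply (i : Fin 2) (n : ℕ) (x : E) : parityIndex E (i, (n, x)) = (n * 2 + i, x) := rfl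

/-- The even sub-sequence of a sequence noise. -/
def evenPart (ω : ℕ × E → G) : ℕ × E → G := fun p => ω (parityIndex E (0, p))

/-- The odd sub-sequence of a sequence noise. -/
def oddPart (ω : ℕ × E → G) : ℕ × E → G := fun p => ω (parityIndex E (1, p))

/-- Splitting a sequence noise into its even and odd sub-sequences. -/
def splitNoise (ω : ℕ × E → G) : (ℕ × E → G) × (ℕ × E → G) := (evenPart ω, oddPart ω)

/-- `evenPart` is measurable. -/
theorem measurable_evenPart : Measurable (evenPart (E := E) (G := G)) :=
  measurable_pi_lambda _ fun _ => measurable_pi_apply _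

/-- `oddPart` is measurable. -/
theorem measurable_oddPart : Measurable (oddPart (E := E) (G := G)) :=
  measurable_pi_lambda _ fun _ => measurable_pi_apply _

/-- `splitNoise` is measurable. -/
theorem measurable_splitNoise : Measurable (splitNoise (E := E) (G := G)) :=
  measurable_evenPart.prodMk measurable_oddPart

/-- `splitNoise` as a composite of measurable equivalences (re-index by parity, curry, `Fin 2 → · ≃ · × ·`). -/
theorem splitNoise_eq_comp :
    (splitNoise : (ℕ × E → G) → (ℕ × E → G) × (ℕ × E → G)) =
      ⇑MeasurableEquiv.finTwoArrow ∘ ⇑(MeasurableEquiv.curry (Fin 2) (ℕ × E) G) ∘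
        ⇑(MeasurableEquiv.piCongrLeft (fun _ : ℕ × E => G) (parityIndex E)).symm := by
  funext ω
  rfl

variable (μ : Measure G) [IsProbabilityMeasure μ]

/-- **The even and odd halves of an i.i.d. sequence noise are independent i.i.d. sequence noises:** the push-forward of
`⨂_{ℕ × E} μ` under `splitNoise` is `(⨂ μ) ⊗ (⨂ μ)`. -/
theorem infinitePi_map_splitNoise :
    (Measure.infinitePi fun _ : ℕ × E => μ).map splitNoise =
      (Measure.infinitePi fun _ : ℕ × E => μ).prod (Measure.infinitePi fun _ : ℕ × E => μ) := by
  set ν : Measure (ℕ × E → G) := Measure.infinitePi fun _ : ℕ × E => μ with hν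
  have h1 : ν.map ⇑(MeasurableEquiv.piCongrLeft (fun _ : ℕ × E => G) (parityIndex E)).symm =
      Measure.infinitePi fun _ : Fin 2 × (ℕ × E) => μ := by
    have := Measure.infinitePi_map_piCongrLeft (fun _ : ℕ × E => μ) (parityIndex E)
    rw [MeasurableEquiv.map_apply_eq_iff_map_symm_apply_eq] at this
    exact this.symm
  have h2 := Measure.infinitePi_map_curry (fun (_ : Fin 2) (_ : ℕ × E) => μ)
  have h3 : (Measure.infinitePi fun _ : Fin 2 => ν) = Measure.pi fun _ => ν := Measure.infinitePi_eq_pi _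
  have h4 := (measurePreserving_finTwoArrow ν).map_eq
  rw [splitNoise_eq_comp, ← Measure.map_map, ← Measure.map_map, h1, h2, ← hν, h3, h4]
  · exact (MeasurableEquiv.curry (Fin 2) (ℕ × E) G).measurable
  · exact (MeasurableEquiv.piCongrLeft (fun _ : ℕ × E => G) (parityIndex E)).symm.measurable
  · exact MeasurableEquiv.finTwoArrow.measurable
  · exact (MeasurableEquiv.curry (Fin 2) (ℕ × E) G).measurable.comp
      (MeasurableEquiv.piCongrLeft (fun _ : ℕ × E => G) (parityIndex E)).symm.measurable

end Split

/-! ## §2 The law identity of the composite coder -/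

section Law

variable {G : Type} [Group G] [TopologicalSpace G] [IsTopologicalGroup G] [CompactSpace G] [MeasurableSpace G] [BorelSpace G]

/-- `seqNoise` splits into two independent sequence noises. -/
theorem seqNoise_map_splitNoise (S : ℕ) :
    (seqNoise G S).map splitNoise = (seqNoise G S).prod (seqNoise G S) := by
  haveI : IsProbabilityMeasure (haarProbability G) :=
    Literature.RepresentationTheory.CompactGroups.CompactGroup.isProbabilityMeasure_haarMeasure_top
  unfold seqNoise
  exact infinitePi_map_splitNoise _

/-- `seqNoise` is a probability measure. -/
theorem isProbabilityMeasure_seqNoise (S : ℕ) : IsProbabilityMeasure (seqNoise G S) := by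
  haveI : IsProbabilityMeasure (haarProbability G) :=
    Literature.RepresentationTheory.CompactGroups.CompactGroup.isProbabilityMeasure_haarMeasure_top
  unfold seqNoise
  infer_instance

variable {N : ℕ} (ρ : G →* Matrix (Fin N) (Fin N) ℂ) (β : ℝ)

/-- A coarse coder's law identity forces a.e.-measurability of the block field under the Wilson measure. -/
theorem aemeasurable_blockField_of_law {S M : ℕ} {Φ₁ : Noise G (2 * S + 1) → GaugeConfig 4 (2 * S + 1) G}
    (hΦ₁ : Measurable Φ₁)
    (hlaw₁ : (seqNoise G (2 * S + 1)).map Φ₁ =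
      (wilsonMeasure (d := 4) (L := 2 * S + 1) ρ β).map (blockField M (2 * S + 1))) :
    AEMeasurable (blockField (G := G) M (2 * S + 1)) (wilsonMeasure (d := 4) (L := 2 * S + 1) ρ β) := by
  haveI : IsProbabilityMeasure (seqNoise G (2 * S + 1)) := isProbabilityMeasure_seqNoise _
  by_contra h
  rw [Measure.map_of_not_aemeasurable h] at hlaw₁
  have h1 := congrArg (fun m : Measure (GaugeConfig 4 (2 * S + 1) G) => m Set.univ) hlaw₁
  simp only [Measure.map_apply hΦ₁ MeasurableSet.univ, Set.preimage_univ, measure_univ,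
    Measure.coe_zero, Pi.zero_apply, one_ne_zero] at h1

/-- A coarse coder's law identity forces the Wilson measure to be a probability measure. -/
theorem isProbabilityMeasure_wilson_of_law {S M : ℕ} {Φ₁ : Noise G (2 * S + 1) → GaugeConfig 4 (2 * S + 1) G}
    (hΦ₁ : Measurable Φ₁)
    (hlaw₁ : (seqNoise G (2 * S + 1)).map Φ₁ =
      (wilsonMeasure (d := 4) (L := 2 * S + 1) ρ β).map (blockField M (2 * S + 1))) :
    IsProbabilityMeasure (wilsonMeasure (d := 4) (L := 2 * S + 1) ρ β) := by
  haveI : IsProbabilityMeasure (seqNoise G (2 * S + 1)) := isProbabilityMeasure_seqNoise _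
  have hbF := aemeasurable_blockField_of_law ρ β hΦ₁ hlaw₁
  refine ⟨?_⟩
  have h1 := congrArg (fun m : Measure (GaugeConfig 4 (2 * S + 1) G) => m Set.univ) hlaw₁
  simp only [Measure.map_apply hΦ₁ MeasurableSet.univ, Set.preimage_univ, measure_univ,
    Measure.map_apply_of_aemeasurable hbF MeasurableSet.univ] at h1
  exact h1.symm

/-- **Law of the pair fed to the conditional stage**: `(Bl (Φ₁ ω_even), ω_odd)` has law `(blockField)_* wilson ⊗ seqNoise` whenever `Φ₁`
codes the block field and `Bl` fixes block fields. -/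
theorem law_pair_of_coders {S M : ℕ} {Φ₁ : Noise G (2 * S + 1) → GaugeConfig 4 (2 * S + 1) G} (hΦ₁ : Measurable Φ₁)
    (hlaw₁ : (seqNoise G (2 * S + 1)).map Φ₁ =
      (wilsonMeasure (d := 4) (L := 2 * S + 1) ρ β).map (blockField M (2 * S + 1)))
    {Bl : GaugeConfig 4 (2 * S + 1) G → GaugeConfig 4 (2 * S + 1) G} (hBl : Measurable Bl)
    (hBlb : ∀ U : GaugeConfig 4 (2 * S + 1) G, Bl (blockField M (2 * S + 1) U) = blockField M (2 * S + 1) U) :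
    (seqNoise G (2 * S + 1)).map (fun ω => (Bl (Φ₁ (evenPart ω)), oddPart ω)) =
      ((wilsonMeasure (d := 4) (L := 2 * S + 1) ρ β).map (blockField M (2 * S + 1))).prod (seqNoise G (2 * S + 1)) := by
  haveI : IsProbabilityMeasure (seqNoise G (2 * S + 1)) := isProbabilityMeasure_seqNoise _
  have hbF := aemeasurable_blockField_of_law ρ β hΦ₁ hlaw₁
  have hT : (fun ω : Noise G (2 * S + 1) => (Bl (Φ₁ (evenPart ω)), oddPart ω)) =
      Prod.map (Bl ∘ Φ₁) id ∘ splitNoise := by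
    funext ω; rfl
  rw [hT, ← Measure.map_map ((hBl.comp hΦ₁).prodMap measurable_id) measurable_splitNoise, seqNoise_map_splitNoise,
    ← Measure.map_prod_map _ _ (hBl.comp hΦ₁) measurable_id, Measure.map_id,
    ← Measure.map_map hBl hΦ₁, hlaw₁, AEMeasurable.map_map_of_aemeasurable hBl.aemeasurable hbF]
  have hc : Bl ∘ blockField M (2 * S + 1) = blockField (G := G) M (2 * S + 1) := funext hBlb
  rw [hc]

/-- **The law identity of the composite coder**: `Φ ω = Ψ (Bl (Φ₁ ω_even), ω_odd)` codes the Wilson measure. -/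
theorem law_compose_of_coders {S M : ℕ} {Φ₁ : Noise G (2 * S + 1) → GaugeConfig 4 (2 * S + 1) G} (hΦ₁ : Measurable Φ₁)
    (hlaw₁ : (seqNoise G (2 * S + 1)).map Φ₁ =
      (wilsonMeasure (d := 4) (L := 2 * S + 1) ρ β).map (blockField M (2 * S + 1)))
    {Ψ : GaugeConfig 4 (2 * S + 1) G × Noise G (2 * S + 1) → GaugeConfig 4 (2 * S + 1) G} (hΨ : Measurable Ψ)
    (hlaw₂ : (((wilsonMeasure (d := 4) (L := 2 * S + 1) ρ β).map (blockField M (2 * S + 1))).prod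
        (seqNoise G (2 * S + 1))).map (fun p => (p.1, Ψ p)) =
      (wilsonMeasure (d := 4) (L := 2 * S + 1) ρ β).map (fun U => (blockField M (2 * S + 1) U, U)))
    {Bl : GaugeConfig 4 (2 * S + 1) G → GaugeConfig 4 (2 * S + 1) G} (hBl : Measurable Bl)
    (hBlb : ∀ U : GaugeConfig 4 (2 * S + 1) G, Bl (blockField M (2 * S + 1) U) = blockField M (2 * S + 1) U) :
    (seqNoise G (2 * S + 1)).map (fun ω => Ψ (Bl (Φ₁ (evenPart ω)), oddPart ω)) =
      wilsonMeasure (d := 4) (L := 2 * S + 1) ρ β := by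
  haveI : IsProbabilityMeasure (seqNoise G (2 * S + 1)) := isProbabilityMeasure_seqNoise _
  have hbF := aemeasurable_blockField_of_law ρ β hΦ₁ hlaw₁
  have hT : Measurable fun ω : Noise G (2 * S + 1) => (Bl (Φ₁ (evenPart ω)), oddPart ω) :=
    (hBl.comp (hΦ₁.comp measurable_evenPart)).prodMk measurable_oddPart
  have hg : Measurable fun p : GaugeConfig 4 (2 * S + 1) G × Noise G (2 * S + 1) => (p.1, Ψ p) :=
    measurable_fst.prodMk hΨ
  have hΦ : (fun ω : Noise G (2 * S + 1) => Ψ (Bl (Φ₁ (evenPart ω)), oddPart ω)) =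
      Prod.snd ∘ (fun p : GaugeConfig 4 (2 * S + 1) G × Noise G (2 * S + 1) => (p.1, Ψ p)) ∘
        fun ω => (Bl (Φ₁ (evenPart ω)), oddPart ω) := by
    funext ω; rfl
  rw [hΦ, ← Measure.map_map measurable_snd (hg.comp hT), ← Measure.map_map hg hT,
    law_pair_of_coders ρ β hΦ₁ hlaw₁ hBl hBlb, hlaw₂]
  have hpair : AEMeasurable (fun U : GaugeConfig 4 (2 * S + 1) G => (blockField M (2 * S + 1) U, U))
      (wilsonMeasure (d := 4) (L := 2 * S + 1) ρ β) := hbF.prodMk aemeasurable_id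
  rw [AEMeasurable.map_map_of_aemeasurable measurable_snd.aemeasurable hpair]
  exact Measure.map_id

end Law

end Summit.QuantumFields.YangMills.Cruxes.IR.TelescopedCoding

end
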